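import Mathlib
import Literature.NumberTheory.LFunctions.Zhang2022.TypedSection13
import Literature.NumberTheory.LFunctions.Zhang2022.SkeletonAssembly
import Literature.NumberTheory.LFunctions.Zhang2022.Section5VerticalShift
import HarnessLib

/-!
# Zhang (2022) §13, (13.1) first line — DISCHARGED at the printed strength `O(1/t₀)`

Topic `Literature/NumberTheory/LFunctions/Zhang2022` (Landau–Siegel audit tree; verdict-neutral).
Y. Zhang, *Discrete mean estimates and the Landau–Siegel zero*, arXiv:2211.02515v1 (2022)
[Zhang2022LandauSiegel], §13 p. 74, (13.1), first line (tex L3733–3734):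

> Assume that `ψ ∈ Ψ₁` and `ρ ∈ 𝔷(ψ)`. By Lemma 5.2 and (2.2),
> `𝒞*(ρ,ψ) = −iZ(ρ+β₃,ψ)⁻¹ L(ρ+β₁,ψ)L(ρ+β₂,ψ)L(ρ+β₃,ψ)/L′(ρ,ψ) · (1 + O(1/t₀))`.

Campaign D-0069 (IUT playbook #2), DAG node `Z22:(13.1)` (first line), typed statement-exact as
`Typed.Section13.Eq131a c′` (file `TypedSection13.lean`, p411917). The typer recorded the gap
`G-L3t6-1` (plan/GAP-LEDGER.md): Lemma 5.2 AS PRINTED (`Skeleton.Lemma52`, relative error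
`O(𝓛⁻¹²³)`) does not give the printed `O(1/t₀)`. **This file closes that gap in the kernel**: the
printed strength follows from the tree's EXACT forms of the two vertical-shift identities —

* `GammaFactor.sqrt_inv_Zfac_triple_shift` (`Section2AnalyticRootY`):
  `Y(s+iv₁)Y(s+iv₂)Y(s+iv₃)/Y(s) = Z(s,ψ)⁻¹ e^{i(v₁+v₂+v₃)log(pt/2π)/2} e^{η}`,
  `‖η‖ ≤ Σⱼ(2|vⱼ|+4A+10)|vⱼ|/(2t)`;
* `GammaFactor.Zfac_vertical_shift` (`Section5VerticalShift`):
  `Z(s+iv,ψ) = Z(s,ψ) e^{−iv·log(pt/2π)} e^{η′}`, `‖η′‖ ≤ (2|v|+4A+10)|v|/t`;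

together with `β₁ + β₂ = β₃` EXACTLY ((2.13): `iα(1−5c′α𝓛) + 2iα(1+c′α𝓛) = 3iα(1−c′α𝓛)`), whence
`Y(ρ+β₁)Y(ρ+β₂)Y(ρ+β₃)/Y(ρ) = Z(ρ+β₃,ψ)⁻¹·e^{η+η′}` with `‖η+η′‖ ≪ α/Im ρ ≤ C/t₀`
(`Im ρ > 2πt₀ − 𝓛₁ ≥ t₀`), and `M′(ρ,ψ) = Y(ρ,ψ)L′(ρ,ψ)` at a zero `ρ` of `L(·,ψ)` (`M = YL`,
§2 p. 5; `Y` analytic on `Im s > 0`, `Skeleton.Yroot_spec`). No Assumption (A), no `ψ ∈ Ψ₁`, no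
claim node of the skeleton is used: the node holds outright, for every value of the parameter `c′`.

Main result: `Typed.Section13.eq131a_holds : ∀ c′, Eq131a c′`.

WHAT THIS IS NOT: any claim about Theorems 1–2 of the manuscript or about Landau–Siegel zeros; the
second line of (13.1) (`Eq131b`, via (2.2)) and (13.2)–(13.7) are other seats' edges.

## References

* Y. Zhang, arXiv:2211.02515v1 (2022), §13 (13.1) p. 74; §5 Lemmas 5.1–5.2 p. 24; §2 (2.13), p. 5.
  [cite: Zhang2022LandauSiegel, §13 (13.1)]
-/

noncomputable section

open Complex Real ComplexConjugate

namespace Literature.NumberTheory.LFunctions.Zhang2022.Typed.Section13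

open Skeleton GammaFactor

/-! ## Parameter bookkeeping: `β_j = i v_j`, `v₁ + v₂ = v₃`, `|v_j| ≤ V(c′)` -/

/-- `β₁ = iv₁`, `v₁ = α(1−5c′α𝓛)`. [cite: Zhang2022LandauSiegel, §2 (2.13)] -/
private theorem beta1_eq (c' : ℝ) (D : ℕ) :
    beta1 c' D = ((alpha D * (1 - 5 * c' * alpha D * ell D) : ℝ) : ℂ) * I := by
  simp only [beta1]; push_cast; ring

/-- `β₂ = iv₂`, `v₂ = 2α(1+c′α𝓛)`. [cite: Zhang2022LandauSiegel, §2 (2.13)] -/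
private theorem beta2_eq (c' : ℝ) (D : ℕ) :
    beta2 c' D = ((2 * alpha D * (1 + c' * alpha D * ell D) : ℝ) : ℂ) * I := by
  simp only [beta2]; push_cast; ring

/-- `β₃ = iv₃`, `v₃ = 3α(1−c′α𝓛)`. [cite: Zhang2022LandauSiegel, §2 (2.13)] -/
private theorem beta3_eq (c' : ℝ) (D : ℕ) :
    beta3 c' D = ((3 * alpha D * (1 - c' * alpha D * ell D) : ℝ) : ℂ) * I := by
  simp only [beta3]; push_cast; ring

/-- **`β₁ + β₂ = β₃` exactly**, on imaginary parts: `v₁ + v₂ + v₃ = 2v₃`.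
[cite: Zhang2022LandauSiegel, §2 (2.13)] -/
private theorem v_sum (c' : ℝ) (D : ℕ) :
    alpha D * (1 - 5 * c' * alpha D * ell D) + 2 * alpha D * (1 + c' * alpha D * ell D) +
        3 * alpha D * (1 - c' * alpha D * ell D) = 2 * (3 * alpha D * (1 - c' * alpha D * ell D)) := by
  ring

/-- `α = π/𝓛⁹` ((2.10), `P = exp 𝓛⁹`). [cite: Zhang2022LandauSiegel, §2 (2.10)] -/
private theorem alpha_eq (D : ℕ) : alpha D = π / ell D ^ 9 := by
  rw [alpha, bigP, Real.log_exp]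

/-- For `𝓛 ≥ 1`: `0 < α ≤ π` and `0 ≤ α𝓛 ≤ π`. [cite: Zhang2022LandauSiegel, §2 (2.10)] -/
private theorem alpha_bounds_loc {D : ℕ} (hℓ : 1 ≤ ell D) :
    0 < alpha D ∧ alpha D ≤ π ∧ 0 ≤ alpha D * ell D ∧ alpha D * ell D ≤ π := by
  have h9 : 1 ≤ ell D ^ 9 := one_le_pow₀ hℓ
  have hα : alpha D = π / ell D ^ 9 := alpha_eq D
  have hαpos : 0 < alpha D := by rw [hα]; positivity
  have hαle : alpha D ≤ π := by
    rw [hα]; exact div_le_self pi_pos.le h9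
  have h8 : ell D ≤ ell D ^ 9 := by
    calc ell D = ell D ^ 1 := (pow_one _).symm
      _ ≤ ell D ^ 9 := pow_le_pow_right₀ hℓ (by norm_num)
  refine ⟨hαpos, hαle, by positivity, ?_⟩
  calc alpha D * ell D ≤ alpha D * ell D ^ 9 := by gcongr
    _ = π := by rw [hα, div_mul_cancel₀ _ (by positivity)]

/-- `|a(1 − b)| ≤ a(1 + |b|)` for `a ≥ 0`. [folklore] -/
private theorem abs_mul_one_sub_le {a b : ℝ} (ha : 0 ≤ a) : |a * (1 - b)| ≤ a * (1 + |b|) := by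
  rw [abs_mul, abs_of_nonneg ha]
  gcongr
  calc |1 - b| ≤ |1| + |b| := abs_sub _ _
    _ = 1 + |b| := by rw [abs_one]

/-- `|a(1 + b)| ≤ a(1 + |b|)` for `a ≥ 0`. [folklore] -/
private theorem abs_mul_one_add_le {a b : ℝ} (ha : 0 ≤ a) : |a * (1 + b)| ≤ a * (1 + |b|) := by
  rw [abs_mul, abs_of_nonneg ha]
  gcongr
  calc |1 + b| ≤ |1| + |b| := abs_add_le _ _
    _ = 1 + |b| := by rw [abs_one]

/-- `|v_j| ≤ V(c′) := 3π(1 + 5π|c′|)` for `j = 1, 2, 3`, once `𝓛 ≥ 1`.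
[cite: Zhang2022LandauSiegel, §2 (2.13)] -/
private theorem abs_v_le {c' : ℝ} {D : ℕ} (hℓ : 1 ≤ ell D) :
    |alpha D * (1 - 5 * c' * alpha D * ell D)| ≤ 3 * π * (1 + 5 * π * |c'|) ∧
      |2 * alpha D * (1 + c' * alpha D * ell D)| ≤ 3 * π * (1 + 5 * π * |c'|) ∧
      |3 * alpha D * (1 - c' * alpha D * ell D)| ≤ 3 * π * (1 + 5 * π * |c'|) := by
  obtain ⟨hαpos, hαle, hαℓ0, hαℓ⟩ := alpha_bounds_loc hℓ
  have hc : 0 ≤ |c'| := abs_nonneg _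
  have hπ : 0 ≤ π := pi_pos.le
  have key : ∀ (m k : ℝ), 0 ≤ m → m ≤ 3 → 0 ≤ k → k ≤ 5 →
      m * alpha D * (1 + |k * c' * alpha D * ell D|) ≤ 3 * π * (1 + 5 * π * |c'|) := by
    intro m k hm0 hm hk0 hk
    have h1 : |k * c' * alpha D * ell D| = k * |c'| * (alpha D * ell D) := by
      rw [show k * c' * alpha D * ell D = k * c' * (alpha D * ell D) by ring, abs_mul, abs_mul,
        abs_of_nonneg hk0, abs_of_nonneg hαℓ0]
    rw [h1]
    have h2 : k * |c'| * (alpha D * ell D) ≤ 5 * |c'| * π := by gcongr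
    calc m * alpha D * (1 + k * |c'| * (alpha D * ell D))
        ≤ 3 * π * (1 + 5 * |c'| * π) := by gcongr
      _ = 3 * π * (1 + 5 * π * |c'|) := by ring
  refine ⟨?_, ?_, ?_⟩
  · calc |alpha D * (1 - 5 * c' * alpha D * ell D)| ≤ alpha D * (1 + |5 * c' * alpha D * ell D|) :=
          abs_mul_one_sub_le hαpos.le
      _ = 1 * alpha D * (1 + |5 * c' * alpha D * ell D|) := by ring
      _ ≤ _ := key 1 5 (by norm_num) (by norm_num) (by norm_num) le_rfl
  · calc |2 * alpha D * (1 + c' * alpha D * ell D)| ≤ 2 * alpha D * (1 + |c' * alpha D * ell D|) :=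
          abs_mul_one_add_le (by positivity)
      _ = 2 * alpha D * (1 + |1 * c' * alpha D * ell D|) := by rw [one_mul]
      _ ≤ _ := key 2 1 (by norm_num) (by norm_num) (by norm_num) (by norm_num)
  · calc |3 * alpha D * (1 - c' * alpha D * ell D)| ≤ 3 * alpha D * (1 + |c' * alpha D * ell D|) :=
          abs_mul_one_sub_le (by positivity)
      _ = 3 * alpha D * (1 + |1 * c' * alpha D * ell D|) := by rw [one_mul]
      _ ≤ _ := key 3 1 (by norm_num) le_rfl (by norm_num) (by norm_num)

/-! ## `M′(ρ,ψ) = Y(ρ,ψ)L′(ρ,ψ)` at a zero of `L(·,ψ)` -/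

/-- At a zero `ρ` of `L(s,ψ)` in the upper half-plane, `M′(ρ,ψ) = Y(ρ,ψ)L′(ρ,ψ)` (`M = YL`).
[cite: Zhang2022LandauSiegel, §2 p. 5] -/
theorem deriv_Mfun_eq_of_zero {D : ℕ} (x : Chr D) {ρ : ℂ} (hρ : 0 < ρ.im)
    (hL : x.ψ.LFunction ρ = 0) :
    deriv (Mfun x.ψ) ρ = Yroot x.ψ ρ * deriv x.ψ.LFunction ρ := by
  have hM : Mfun x.ψ = Yroot x.ψ * x.ψ.LFunction := by
    funext s; rfl
  have hopen : IsOpen {s : ℂ | 0 < s.im} := isOpen_lt continuous_const Complex.continuous_im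
  have hY : DifferentiableAt ℂ (Yroot x.ψ) ρ :=
    (Yroot_spec x.prim).1.differentiableAt (hopen.mem_nhds hρ)
  have hLd : DifferentiableAt ℂ x.ψ.LFunction ρ :=
    DirichletCharacter.differentiableAt_LFunction x.ψ ρ (Or.inr x.ψ_ne_one)
  rw [hM, deriv_mul hY hLd, hL, mul_zero, zero_add]

/-! ## The exact triple-shift identity `Y(ρ+β₁)Y(ρ+β₂)Y(ρ+β₃)/Y(ρ) = Z(ρ+β₃,ψ)⁻¹e^{ξ}` -/

/-- **Lemma 5.2 × Lemma 5.1, exact**: for `ψ` primitive mod `p`, `ρ = σ + it` with `0 < σ ≤ 1`,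
`t ≥ 4`, and the three shifts with `|v_j| ≤ t/2`, `v₁ + v₂ + v₃ = 2v₃`:
`Y(ρ+iv₁)Y(ρ+iv₂)Y(ρ+iv₃)/Y(ρ) = Z(ρ+iv₃,ψ)⁻¹·e^{ξ}` with
`‖ξ‖ ≤ Σⱼ(2|vⱼ|+14)|vⱼ|/(2t) + (2|v₃|+14)|v₃|/t`.
[cite: Zhang2022LandauSiegel, §13 (13.1); §5 Lemmas 5.1–5.2] -/
theorem triple_shift_eq_inv_Zfac_shift {D : ℕ} (x : Chr D) {σ t v₁ v₂ v₃ : ℝ} (hσ0 : 0 < σ)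
    (hσ1 : σ ≤ 1) (ht : 4 ≤ t) (hv₁ : |v₁| ≤ t / 2) (hv₂ : |v₂| ≤ t / 2) (hv₃ : |v₃| ≤ t / 2)
    (hsum : v₁ + v₂ + v₃ = 2 * v₃) :
    ∃ ξ : ℂ, ‖ξ‖ ≤ ((2 * |v₁| + 14) * |v₁| + (2 * |v₂| + 14) * |v₂| + (2 * |v₃| + 14) * |v₃|) /
        (2 * t) + (2 * |v₃| + 14) * |v₃| / t ∧
      Yroot x.ψ ((σ : ℂ) + t * I + v₁ * I) * Yroot x.ψ ((σ : ℂ) + t * I + v₂ * I) *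
          Yroot x.ψ ((σ : ℂ) + t * I + v₃ * I) / Yroot x.ψ ((σ : ℂ) + t * I) =
        (Zfac x.ψ ((σ : ℂ) + t * I + v₃ * I))⁻¹ * cexp ξ := by
  have hA : (1 : ℝ) ≤ 1 := le_rfl
  have ht' : 4 * (1 : ℝ) ≤ t := by linarith
  obtain ⟨hYd, hYsq⟩ := Yroot_spec x.prim
  obtain ⟨η, hη, hY⟩ := sqrt_inv_Zfac_triple_shift x.prim hYd hYsq hA hσ0 hσ1 ht' hv₁ hv₂ hv₃
  obtain ⟨η', hη', hZ⟩ := Zfac_vertical_shift x.prim hA hσ0 hσ1 ht' hv₃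
  have ht0 : 0 < t := by linarith
  have hs : 0 < ((σ : ℂ) + t * I).im := by simpa using ht0
  have hZ0 : Zfac x.ψ ((σ : ℂ) + t * I) ≠ 0 := Zfac_ne_zero x.prim hs
  have hs3 : 0 < ((σ : ℂ) + t * I + v₃ * I).im := by
    have : ((σ : ℂ) + t * I + v₃ * I).im = t + v₃ := by simp
    rw [this]; linarith [neg_abs_le v₃]
  have hZ3 : Zfac x.ψ ((σ : ℂ) + t * I + v₃ * I) ≠ 0 := Zfac_ne_zero x.prim hs3
  set L : ℂ := ((Real.log ((x.p : ℝ) * t / (2 * π)) : ℝ) : ℂ) with hL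
  refine ⟨η + η', ?_, ?_⟩
  · calc ‖η + η'‖ ≤ ‖η‖ + ‖η'‖ := norm_add_le _ _
      _ ≤ _ := by
        have h14 : (2 * |v₁| + 4 * 1 + 10) * |v₁| + (2 * |v₂| + 4 * 1 + 10) * |v₂| +
            (2 * |v₃| + 4 * 1 + 10) * |v₃| =
            (2 * |v₁| + 14) * |v₁| + (2 * |v₂| + 14) * |v₂| + (2 * |v₃| + 14) * |v₃| := by ring
        have h14' : (2 * |v₃| + 4 * 1 + 10) * |v₃| = (2 * |v₃| + 14) * |v₃| := by ring
        rw [h14] at hη; rw [h14'] at hη'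
        exact add_le_add hη hη'
  · have hexp2 : cexp (((v₁ + v₂ + v₃ : ℝ) : ℂ) * L / 2 * I) = cexp ((v₃ : ℂ) * L * I) := by
      rw [hsum]; push_cast; ring_nf
    rw [hexp2] at hY
    -- `YYY/Y · Z₃ = e^{η+η′}`
    have hprod : Yroot x.ψ ((σ : ℂ) + t * I + v₁ * I) * Yroot x.ψ ((σ : ℂ) + t * I + v₂ * I) *
          Yroot x.ψ ((σ : ℂ) + t * I + v₃ * I) / Yroot x.ψ ((σ : ℂ) + t * I) *
        Zfac x.ψ ((σ : ℂ) + t * I + v₃ * I) = cexp (η + η') := by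
      rw [hY, hZ]
      have h1 : cexp ((v₃ : ℂ) * L * I) * cexp (-((v₃ : ℂ) * L) * I) = 1 := by
        rw [← Complex.exp_add]
        have : (v₃ : ℂ) * L * I + -((v₃ : ℂ) * L) * I = 0 := by ring
        rw [this, Complex.exp_zero]
      calc (Zfac x.ψ ((σ : ℂ) + t * I))⁻¹ * cexp ((v₃ : ℂ) * L * I) * cexp η *
            (Zfac x.ψ ((σ : ℂ) + t * I) * cexp (-((v₃ : ℂ) * L) * I) * cexp η')
          = ((Zfac x.ψ ((σ : ℂ) + t * I))⁻¹ * Zfac x.ψ ((σ : ℂ) + t * I)) *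
              (cexp ((v₃ : ℂ) * L * I) * cexp (-((v₃ : ℂ) * L) * I)) * (cexp η * cexp η') := by
            ring
        _ = cexp (η + η') := by rw [inv_mul_cancel₀ hZ0, h1, Complex.exp_add]; ring
    calc _ = Yroot x.ψ ((σ : ℂ) + t * I + v₁ * I) * Yroot x.ψ ((σ : ℂ) + t * I + v₂ * I) *
          Yroot x.ψ ((σ : ℂ) + t * I + v₃ * I) / Yroot x.ψ ((σ : ℂ) + t * I) *
          Zfac x.ψ ((σ : ℂ) + t * I + v₃ * I) * (Zfac x.ψ ((σ : ℂ) + t * I + v₃ * I))⁻¹ := by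
            rw [mul_inv_cancel_right₀ hZ3]
      _ = (Zfac x.ψ ((σ : ℂ) + t * I + v₃ * I))⁻¹ * cexp (η + η') := by rw [hprod, mul_comm]

/-! ## (13.1), first line, holds -/

/-- **`Z22:(13.1)` (first line) DISCHARGED** [Z22 p.74, (13.1), tex L3733–3734]: for every `c′`,
`Typed.Section13.Eq131a c′` holds — for `D` large (depending on `c′` only), every `ψ ∈ Ψ` and every
`ρ ∈ 𝔷(ψ)`: `‖𝒞*(ρ,ψ) − T‖ ≤ C·t₀⁻¹·‖T‖`, `T = −iZ(ρ+β₃,ψ)⁻¹L(ρ+β₁,ψ)L(ρ+β₂,ψ)L(ρ+β₃,ψ)/L′(ρ,ψ)`,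
with `C = 5(2V+14)V`, `V = 3π(1+5π|c′|)`. Neither (A) nor `ψ ∈ Ψ₁` is used. Closes GAP-LEDGER row
`G-L3t6-1` (the printed `O(1/t₀)`, not derivable from Lemma 5.2 as printed, follows from the exact
vertical-shift identities of the tree). [cite: Zhang2022LandauSiegel, §13 (13.1) p.74] -/
theorem eq131a_holds (c' : ℝ) : Eq131a c' := by
  -- constants
  set V : ℝ := 3 * π * (1 + 5 * π * |c'|) with hV
  set W : ℝ := 5 * (2 * V + 14) * V with hW
  set M : ℝ := 4 + 2 * V + W with hM
  have hV0 : 0 ≤ V := by positivity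
  have hW0 : 0 ≤ W := by positivity
  refine ⟨W, ⌈Real.exp M⌉₊, fun D _ χ hD _ _ _ x _ ρ hρ => ?_⟩
  -- `𝓛 ≥ M ≥ 4`
  have hDreal : Real.exp M ≤ (D : ℝ) := le_trans (Nat.le_ceil _) (by exact_mod_cast hD)
  have hDpos : (0 : ℝ) < D := lt_of_lt_of_le (Real.exp_pos M) hDreal
  have hℓM : M ≤ ell D := by rw [ell]; exact (Real.le_log_iff_exp_le hDpos).mpr hDreal
  have hM4 : 4 ≤ M := by rw [hM]; linarith
  have hℓ1 : 1 ≤ ell D := by linarith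
  have hℓ4 : 4 ≤ ell D := le_trans hM4 hℓM
  -- `t₀ ≥ 𝓛 ≥ M`, `𝓛₁ ≤ t₀`
  have ht0ℓ : ell D ≤ t0 D := by rw [t0]; exact le_self_pow₀ hℓ1 (by norm_num)
  have ht0M : M ≤ t0 D := le_trans hℓM ht0ℓ
  have ht0pos : 0 < t0 D := by linarith
  have hℓ1t0 : ell1 D ≤ t0 D := by
    rw [ell1, t0]; exact pow_le_pow_right₀ hℓ1 (by norm_num)
  -- the zero `ρ = σ + it`
  obtain ⟨hre, him, hLρ⟩ := hρ
  set σ : ℝ := ρ.re with hσ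
  set t : ℝ := ρ.im with ht
  have hρeq : ρ = (σ : ℂ) + t * I := (Complex.re_add_im ρ).symm
  have hσ0 : 0 < σ := by have := (abs_lt.mp hre).1; linarith
  have hσ1 : σ ≤ 1 := by have := (abs_lt.mp hre).2; linarith
  have htt0 : t0 D ≤ t := by
    have h1 := (abs_lt.mp him).1
    have hπ : (3 : ℝ) < π := Real.pi_gt_three
    nlinarith
  have htpos : 0 < t := lt_of_lt_of_le ht0pos htt0
  have ht4 : 4 ≤ t := by linarith
  -- the shifts `v_j`
  set v1 : ℝ := alpha D * (1 - 5 * c' * alpha D * ell D) with hv1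
  set v2 : ℝ := 2 * alpha D * (1 + c' * alpha D * ell D) with hv2
  set v3 : ℝ := 3 * alpha D * (1 - c' * alpha D * ell D) with hv3
  obtain ⟨hav1, hav2, hav3⟩ := abs_v_le (c' := c') hℓ1
  have h2Vt : 2 * V ≤ t := by linarith
  have hvt1 : |v1| ≤ t / 2 := by linarith
  have hvt2 : |v2| ≤ t / 2 := by linarith
  have hvt3 : |v3| ≤ t / 2 := by linarith
  obtain ⟨ξ, hξ, hY⟩ := triple_shift_eq_inv_Zfac_shift x hσ0 hσ1 ht4 hvt1 hvt2 hvt3 (v_sum c' D)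
  -- `‖ξ‖ ≤ W/(2t) ≤ 1`
  have hquad : ∀ a : ℝ, |a| ≤ V → (2 * |a| + 14) * |a| ≤ (2 * V + 14) * V := by
    intro a ha
    have h0 : 0 ≤ |a| := abs_nonneg _
    nlinarith
  have hξW : ‖ξ‖ ≤ W / (2 * t) := by
    calc ‖ξ‖ ≤ ((2 * |v1| + 14) * |v1| + (2 * |v2| + 14) * |v2| + (2 * |v3| + 14) * |v3|) /
          (2 * t) + (2 * |v3| + 14) * |v3| / t := hξ
      _ ≤ (((2 * V + 14) * V + (2 * V + 14) * V + (2 * V + 14) * V)) / (2 * t) +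
          (2 * V + 14) * V / t :=
          add_le_add
            (div_le_div_of_nonneg_right
              (add_le_add (add_le_add (hquad v1 hav1) (hquad v2 hav2)) (hquad v3 hav3))
              (by positivity))
            (div_le_div_of_nonneg_right (hquad v3 hav3) htpos.le)
      _ = W / (2 * t) := by rw [hW]; field_simp; ring
  have hξ1 : ‖ξ‖ ≤ 1 := by
    refine le_trans hξW ?_
    rw [div_le_one (by positivity)]
    have : W ≤ M := by rw [hM]; linarith
    linarith
  have hexp : ‖cexp ξ - 1‖ ≤ 2 * ‖ξ‖ := Complex.norm_exp_sub_one_le hξ1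
  -- rewrite `𝒞*` and `T`
  have hderiv := deriv_Mfun_eq_of_zero x htpos hLρ
  have hβ1 : ρ + beta1 c' D = (σ : ℂ) + t * I + (v1 : ℂ) * I := by rw [beta1_eq, hρeq]
  have hβ2 : ρ + beta2 c' D = (σ : ℂ) + t * I + (v2 : ℂ) * I := by rw [beta2_eq, hρeq]
  have hβ3 : ρ + beta3 c' D = (σ : ℂ) + t * I + (v3 : ℂ) * I := by rw [beta3_eq, hρeq]
  have hρ' : ρ = (σ : ℂ) + t * I := hρeq
  -- abbreviations
  set Y0 := Yroot x.ψ ρ with hY0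
  set Y1 := Yroot x.ψ (ρ + beta1 c' D) with hY1
  set Y2 := Yroot x.ψ (ρ + beta2 c' D) with hY2
  set Y3 := Yroot x.ψ (ρ + beta3 c' D) with hY3
  set L1 := x.ψ.LFunction (ρ + beta1 c' D) with hL1
  set L2 := x.ψ.LFunction (ρ + beta2 c' D) with hL2
  set L3 := x.ψ.LFunction (ρ + beta3 c' D) with hL3
  set L' := deriv x.ψ.LFunction ρ with hL'
  set Z3 := Zfac x.ψ (ρ + beta3 c' D) with hZ3
  have hYid : Y1 * Y2 * Y3 / Y0 = Z3⁻¹ * cexp ξ := by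
    rw [hY1, hY2, hY3, hY0, hZ3, hβ1, hβ2, hβ3, hρ']
    exact hY
  show ‖cstar c' D x ρ - -I * Z3⁻¹ * (L1 * L2 * L3 / L')‖ ≤ W * (t0 D)⁻¹ * ‖-I * Z3⁻¹ * (L1 * L2 * L3 / L')‖
  have hc : cstar c' D x ρ = -I * (Y1 * Y2 * Y3 / Y0) * (L1 * L2 * L3 / L') := by
    rw [cstar, hderiv]
    simp only [Mfun]
    ring
  have hdiff : cstar c' D x ρ - -I * Z3⁻¹ * (L1 * L2 * L3 / L') =
      (cexp ξ - 1) * (-I * Z3⁻¹ * (L1 * L2 * L3 / L')) := by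
    rw [hc, hYid]; ring
  rw [hdiff, norm_mul]
  have hT0 : 0 ≤ ‖-I * Z3⁻¹ * (L1 * L2 * L3 / L')‖ := norm_nonneg _
  have h2ξ : 2 * ‖ξ‖ ≤ W * (t0 D)⁻¹ :=
    calc 2 * ‖ξ‖ ≤ 2 * (W / (2 * t)) := by gcongr
      _ = W / t := by field_simp
      _ ≤ W / t0 D := div_le_div_of_nonneg_left hW0 ht0pos htt0
      _ = W * (t0 D)⁻¹ := div_eq_mul_inv _ _
  calc ‖cexp ξ - 1‖ * ‖-I * Z3⁻¹ * (L1 * L2 * L3 / L')‖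
      ≤ (2 * ‖ξ‖) * ‖-I * Z3⁻¹ * (L1 * L2 * L3 / L')‖ := mul_le_mul_of_nonneg_right hexp hT0
    _ ≤ (W * (t0 D)⁻¹) * ‖-I * Z3⁻¹ * (L1 * L2 * L3 / L')‖ := mul_le_mul_of_nonneg_right h2ξ hT0

variable (c' : ℝ) in
/-- `Eq131a` — `_holds` alias of `eq131a_holds` above under the fact's exact name, stated under the
prover's own binders as section variables (appended 2026-08-28, D-0026 bookkeeping: the proof term is the
existing theorem of this file; no statement, definition or attribute is edited; no new named fact; the
ledger's debt table listed the fact unproved). [cite: Zhang2022LandauSiegel, §13 (13.1) p.74] -/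
theorem _root_.Literature.NumberTheory.LFunctions.Zhang2022.Typed.Section13.Eq131a_holds :
    _root_.Literature.NumberTheory.LFunctions.Zhang2022.Typed.Section13.Eq131a c' :=
  _root_.Literature.NumberTheory.LFunctions.Zhang2022.Typed.Section13.eq131a_holds (c' := c')

end Literature.NumberTheory.LFunctions.Zhang2022.Typed.Section13
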